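import Summits.BirchSwinnertonDyer.BirchSwinnertonDyer.Theorems.EisensteinPrimesMazurMCOnX1RankZeroInterludeDefs
import Summits.BirchSwinnertonDyer.BirchSwinnertonDyer.Theorems.EisensteinPrimesMazurMCOnX1RankZeroInterludeRoadBLocalIndex
import Literature.NumberTheory.EllipticCurves.Castella2018.AnticyclotomicSelmer
import Literature.NumberTheory.EllipticCurves.GreenbergVatsal2000.GreenbergSelmerGroups
import Literature.NumberTheory.EllipticCurves.IsogenySelmerInfty
import Literature.NumberTheory.EllipticCurves.IsogenySelmerGroups
import Literature.NumberTheory.EllipticCurves.IsogenyGroundFieldExtension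
import Literature.NumberTheory.EllipticCurves.IsogenyDualElliptic
import Literature.NumberTheory.EllipticCurves.IsogenyMulProofs
import Literature.NumberTheory.EllipticCurves.SubgroupSelmerCocycleCriteriaProofs
import Literature.NumberTheory.EllipticCurves.SelmerCorankAssembly
import Literature.NumberTheory.EllipticCurves.IwasawaSelmerProofs
import Literature.NumberTheory.EllipticCurves.GoodReductionUnramifiedProofs
import Literature.NumberTheory.EllipticCurves.ZpExtensionInertiaTorsionCyclotomicProofs
import Literature.NumberTheory.DiophantineGeometry.LocalReductionFiniteBadPlacesProofs
import Literature.NumberTheory.EllipticCurves.SelmerCorankProofs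
import HarnessLib

/-!
# Crux `MazurMCOnX1RankZero` (stmt-BirchSwinnertonDyer-19035), line `interlude_with_torsion` v8 — road B, step (B1c) at degree
# exactly `p`: **`RoadBResidueP` HOLDS** (`InterludeWithTorsion.RoadBResidueP` of `…InterludeDefs`, = registered stub
# `stub_roadBResidueP`), i.e. residual `GL(1)` finiteness (B3) ⟹ the Selmer map along ONE `ℚ`-isogeny of degree `p` has finite kernel

TREE-READY PORT, prepared publish-only by the ideator seat bsd-idea-11 (generation 16; mathematics and kernel text = its companion
workfile `Cruxes/MazurMCOnX1RankZero/Lines/interlude_stepsTwoThree_split_idea11g6_roadB_helpers.lean` rev 3.1, §§Cohomology–Core,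
critic idea-crit-14 V96 PASS) for the LEAD `cruxlead-19035` to land `--supports stmt-BirchSwinnertonDyer-19035`; the algebraic
pieces CL/(R3-alg) are the tree file `…InterludeRoadBLocalIndex` (same namespace, cited BY NAME). Sorry-free; no new `Prop`
currency; the only statement about the line's currencies is the closing theorem `roadBResidueP_holds : RoadBResidueP`
(an IMPLICATION whose antecedent (B3) `ResidualGL1FinitenessOdd` is OPEN). No summit statement, no crux, nothing about BSD /
Mazur's main conjecture / IMC2 is proved here.

REV 2 (generation 16): `roadB_residue_p_core_of_cont` / `kerSelmerMapFiniteOfDegreeP_of_residualCont` — (B1c) at degree `p` BY NAME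
from (B3) FOR CONTINUOUS ACTIONS ONLY (the hypothesis = body of workfile B's `ResidualGL1FinitenessOddCont`): road B instantiates (B3) at
`M = E[ψ₀]`, whose Galois action is continuous (`WeierstrassCurve.continuous_smul_geomPoints`), so (B3)'s junk case is never needed;
with workfile B rev 4 ([P23] a theorem for continuous actions) road B ⟸ the two junk-free classical `μ = 0` inputs [P1]-cont ∧ [Cv]-cont.

PROOF (Greenberg, LNM 1716 §5, proof of Prop. 5.10, run relatively along the isogeny `ψ₀ : W → W'` of degree `p` over the
cyclotomic `ℤ_p`-extension of `K`, strict place `v̄`; memo `Lines/interlude_K2mu_ArnoldKoo_memo_idea11g14.md` §10):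
`ker Sel(ψ₀/K) ↪ {c ∈ Sel(W/K_∞) : ψ₀_* c = 0}`; (R1) such a class is `ι_* d` for a class `d ∈ H¹(H, W[ψ₀])`
(`exists_resH1Hom_eq_of_h1Map_eq_zero`); (R4) `d` is unramified at the good places `v' ∤ p` (forward Néron–Ogg–Shafarevich, tree);
(R2)/(R3) at `v̄` the strict condition on `ι_* d` puts `d` in a subgroup of finite index in the strict kernel for `W[ψ₀]`
(`Γ_K = I_v̄ · H`; the local discrepancy `W'[p^∞]^G/ψ₀(W[p^∞]^G)` is finite by (R3-alg), NO appeal to Imai); (R5)/(R6) with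
`M := W[ψ₀]` (`#M = p`, `Γ_ℚ`-action through `Isogeny.kerAction`, provenance `rfl`) the set of such `d` is finite by the
hypothesis (B3) at `S :=` the bad places. [cite: GreenbergLNM1716, §5, proof of Prop. 5.10] [cite: SilvermanAEC, VII.4.1, III.4.11]
[folklore]
-/

set_option linter.dupNamespace false

namespace Summit.BirchSwinnertonDyer.BirchSwinnertonDyer.Theorems.InterludeWithTorsion.RoadBHelpers

open AddSubgroup Literature.GroupTheory.Abelian

universe u v

variable {M : Type u} [AddCommGroup M]


/-! ## Road B residue pieces (generation 16): memo §10 (R1)–(R6) over the tree's Selmer objects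

Everything below is stated for an ABSTRACT finite discrete `Γ_K`-module `S` with an injective equivariant map
`ι : S → W[p^∞]` onto the kernel of the isogeny `ψ` inside `W[p^∞]` (hypotheses `hinj`, `hιψ`, `hsurj`); the last
section instantiates `S := E[ψ₀]` (over `ℚ`, `Γ_K` acting through `res : Γ_K → Γ_ℚ`) and `ι :=` transport of points
along the chosen `ℚ̄ ≃ K̄`. -/

section Cohomology

open Field Literature.NumberTheory.EllipticCurves Literature.NumberTheory.EllipticCurves.GreenbergSelmer
  Literature.NumberTheory.GaloisRepresentations NumberField IsDedekindDomain

variable {G : Type u} [Group G] [TopologicalSpace G] [IsTopologicalGroup G]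
  {S : Type u} [AddCommGroup S] [DistribMulAction G S] [TopologicalSpace S] [DiscreteTopology S]
  {M : Type u} [AddCommGroup M] [DistribMulAction G M] [TopologicalSpace M] [DiscreteTopology M]

/-- `ι_*` commutes with the conjugation action on `H¹(H, ·)` (both composites are induced by the compatible pair
`(h ↦ σ⁻¹hσ, s ↦ σ • ι s = ι (σ • s))`; the tree's `IsogenySelmerInfty.h1Map_conjH1` for a general equivariant `ι`).
[cite: SerreGaloisCohomology1997, I.§2.4 (functoriality of H¹ for compatible pairs)] -/
theorem resH1Hom_id_conjH1 (H : Subgroup G) [H.Normal] (ι : S →+ M) (hι : ∀ (g : G) (s : S), ι (g • s) = g • ι s)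
    (σ : G) (d : subgroupH1 H S) :
    resH1Hom (ContinuousMonoidHom.id H) ι (fun x s ↦ hι x s) (conjH1 H S σ d) =
      conjH1 H M σ (resH1Hom (ContinuousMonoidHom.id H) ι (fun x s ↦ hι x s) d) := by
  change ((resH1Hom (ContinuousMonoidHom.id H) ι (fun x s ↦ hι x s)).comp (conjH1 H S σ)) d =
    ((conjH1 H M σ).comp (resH1Hom (ContinuousMonoidHom.id H) ι (fun x s ↦ hι x s))) d
  unfold conjH1
  rw [resH1Hom_comp, resH1Hom_comp]
  refine congrArg (fun F : subgroupH1 H S →+ subgroupH1 H M ↦ F d) (resH1Hom_congr ?_ ?_ _ _)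
  · ext; rfl
  · ext s
    simp only [AddMonoidHom.coe_comp, Function.comp_apply, DistribSMul.toAddMonoidHom_apply, hι]

/-- `ι_*` commutes with restriction to a smaller subgroup. [cite: SerreGaloisCohomology1997, I.§2.4–2.5] -/
theorem resOfLe_resH1Hom_id {H₁ H₂ : Subgroup G} (hle : H₁ ≤ H₂) (ι : S →+ M)
    (hι : ∀ (g : G) (s : S), ι (g • s) = g • ι s) (d : subgroupH1 H₂ S) :
    resOfLe M hle (resH1Hom (ContinuousMonoidHom.id H₂) ι (fun x s ↦ hι x s) d) =
      resH1Hom (ContinuousMonoidHom.id H₁) ι (fun x s ↦ hι x s) (resOfLe S hle d) := by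
  change ((resOfLe M hle).comp (resH1Hom (ContinuousMonoidHom.id H₂) ι (fun x s ↦ hι x s))) d =
    ((resH1Hom (ContinuousMonoidHom.id H₁) ι (fun x s ↦ hι x s)).comp (resOfLe S hle)) d
  unfold resOfLe
  rw [resH1Hom_comp, resH1Hom_comp]
  refine congrArg (fun F : subgroupH1 H₂ S →+ subgroupH1 H₁ M ↦ F d) (resH1Hom_congr ?_ ?_ _ _)
  · ext; rfl
  · ext; rfl

/-- `ι_*` injective `ι` : a class `[z]` with `ι_* [z]` restricting to `0` on `H₁` has `ι ∘ z|_{H₁} = ∂a`. Pure unfolding.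
[cite: SerreGaloisCohomology1997, I.§2.4] -/
theorem resOfLe_resH1Hom_id_oneCocycleClass_eq_zero_iff {H₁ H₂ : Subgroup G} (hle : H₁ ≤ H₂) (ι : S →+ M)
    (hι : ∀ (g : G) (s : S), ι (g • s) = g • ι s) (z : contOneCocycles (discreteTopRep H₂ S)) :
    resOfLe M hle (resH1Hom (ContinuousMonoidHom.id H₂) ι (fun x s ↦ hι x s) (oneCocycleClass _ z)) = 0 ↔
      ∃ a : M, ∀ x : H₁, ι (z.1 (Subgroup.inclusion hle x)) = (x : G) • a - a := by
  rw [resH1Hom_id_oneCocycleClass, CocycleCriteria.resOfLe_oneCocycleClass_eq_zero_iff]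
  rfl

variable {K : Type u} [Field K] [NumberField K] (H : Subgroup (absoluteGaloisGroup K))
  (N : Type u) [AddCommGroup N] [DistribMulAction (absoluteGaloisGroup K) N] [TopologicalSpace N] [DiscreteTopology N]

/-- For `d ∈ D_v` and `c ∈ H¹(H, N)` locally trivial at the chosen place above `v`, `conj_d c` is locally trivial there
(on cocycles: `z = ∂a` on `H ⊓ D_v` gives `x ↦ d • z(d⁻¹xd) = ∂(d • a)`). Local copy (with attribution) of the Summits-side
`conjH1_mem_awayKer_of_mem_decomp` (AlignedTransport…FineRoadCokerAtTwo §1), to keep this file's imports inside Literature.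
[cite: SerreGaloisCohomology1997, I §2.5 (conjugation on `H¹(H, M)`)] -/
theorem conjH1_mem_awayKer_of_mem_decomp' [H.Normal] {v : HeightOneSpectrum (𝓞 K)} {d : absoluteGaloisGroup K}
    (hd : d ∈ decomp v) {c : subgroupH1 H N} (hc : c ∈ awayKer H N v) : conjH1 H N d c ∈ awayKer H N v := by
  obtain ⟨z, rfl⟩ := oneCocycleClass_surjective _ c
  rw [awayKer, AddMonoidHom.mem_ker] at hc ⊢
  obtain ⟨a, ha⟩ :=
    (CocycleCriteria.resOfLe_oneCocycleClass_eq_zero_iff (inf_le_left : H ⊓ decomp v ≤ H) z).mp hc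
  refine (CocycleCriteria.conjH1_oneCocycleClass_mem_ker_resOfLe_iff
    (inf_le_left : H ⊓ decomp v ≤ H) d z).mpr ⟨d • a, fun x ↦ ?_⟩
  have hx' : d⁻¹ * (x : absoluteGaloisGroup K) * d ∈ H ⊓ decomp v :=
    ⟨(inferInstance : H.Normal).conj_mem' _ x.2.1 d,
      (decomp v).mul_mem ((decomp v).mul_mem ((decomp v).inv_mem hd) x.2.2) hd⟩
  have e : subgroupConj H d (Subgroup.inclusion (inf_le_left : H ⊓ decomp v ≤ H) x) =
      Subgroup.inclusion (inf_le_left : H ⊓ decomp v ≤ H) ⟨_, hx'⟩ := Subtype.ext rfl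
  have hmul : d * (d⁻¹ * (x : absoluteGaloisGroup K) * d) = (x : absoluteGaloisGroup K) * d := by group
  rw [e, ha ⟨_, hx'⟩, smul_sub, smul_smul, hmul, mul_smul]

/-- **One place above `v`.** If every `σ ∈ Γ_K` is `d · h` with `d ∈ D_v`, `h ∈ H`, the condition «`conj_σ c` locally trivial at
the chosen place above `v` for every `σ`» reduces to «`c` locally trivial there» (`conj_h = id`, `conjH1_of_mem_holds`). Local copy
of the Summits-side `forall_conjH1_mem_awayKer_iff` (one direction). [cite: Greenberg1989, §1 p. 98 ("independent of the choice of places")] -/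
theorem forall_conjH1_mem_awayKer_of_mem [H.Normal] {v : HeightOneSpectrum (𝓞 K)}
    (hgen : ∀ σ : absoluteGaloisGroup K, ∃ d ∈ decomp v, d⁻¹ * σ ∈ H) {c : subgroupH1 H N}
    (h : c ∈ awayKer H N v) (σ : absoluteGaloisGroup K) : conjH1 H N σ c ∈ awayKer H N v := by
  obtain ⟨d, hd, hh⟩ := hgen σ
  rw [show σ = d * (d⁻¹ * σ) by group, conjH1_mul_holds H N, AddMonoidHom.comp_apply,
    conjH1_of_mem_holds H N hh, AddMonoidHom.id_apply]
  exact conjH1_mem_awayKer_of_mem_decomp' H N hd h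

/-- **For Castella's strict datum `M⁺_v = 0`, Greenberg's strict condition at `v` is `awayKer`** (the coefficient map
`N → N ⧸ 0` is injective and `D_v`-equivariant). Re-proved here (the tree's `strictKer_strictDatum_eq_awayKer` lives in
`BigRepModuleShapiroSelmerConditionsProofs`, whose imports we avoid). [cite: Greenberg1989, §1 p. 98 (the strict condition)]
[cite: Castella2018, Def. 2.2 (arXiv:1704.06608 p. 5, "`0` if `w = 𝔭`")] -/
theorem strictKer_strictDatum_eq_awayKer' (v : HeightOneSpectrum (𝓞 K)) :
    (Castella2018.AcSelmer.strictDatum N v).strictKer H = awayKer H N v := by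
  ext c
  obtain ⟨φ, rfl⟩ := oneCocycleClass_surjective _ c
  rw [LocalDatum.mem_strictKer_iff, LocalDatum.strictMap, CocycleCriteria.resH1Hom_oneCocycleClass_eq_zero_iff,
    awayKer, AddMonoidHom.mem_ker, CocycleCriteria.resOfLe_oneCocycleClass_eq_zero_iff]
  constructor
  · rintro ⟨tbar, htbar⟩
    obtain ⟨t, rfl⟩ := (Castella2018.AcSelmer.strictDatum N v).grMk_surjective tbar
    refine ⟨t, fun g ↦ ?_⟩
    have hg := Subgroup.mem_inf.1 g.2
    have h1 := htbar ⟨⟨(g : absoluteGaloisGroup K), hg.2⟩, (mem_decompIn_iff H v _).2 hg.1⟩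
    have h2 : (Castella2018.AcSelmer.strictDatum N v).grMk (φ.1 (Subgroup.inclusion inf_le_left g)) =
        (Castella2018.AcSelmer.strictDatum N v).grMk ((g : absoluteGaloisGroup K) • t - t) := by
      rw [map_sub]
      exact h1
    rw [← sub_eq_zero, ← map_sub, ← AddMonoidHom.mem_ker, LocalDatum.ker_grMk] at h2
    change _ ∈ (⊥ : AddSubgroup N) at h2
    rw [AddSubgroup.mem_bot, sub_eq_zero] at h2
    exact h2
  · rintro ⟨t, ht⟩
    refine ⟨(Castella2018.AcSelmer.strictDatum N v).grMk t, fun g ↦ ?_⟩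
    have hgD : ((g : decomp (K := K) v) : absoluteGaloisGroup K) ∈ decomp v := (g : decomp v).2
    have hgH : ((g : decomp (K := K) v) : absoluteGaloisGroup K) ∈ H := (mem_decompIn_iff H v _).1 g.2
    have h1 := ht ⟨((g : decomp (K := K) v) : absoluteGaloisGroup K), Subgroup.mem_inf.2 ⟨hgH, hgD⟩⟩
    change (Castella2018.AcSelmer.strictDatum N v).grMk (φ.1 ⟨_, hgH⟩) =
      (Castella2018.AcSelmer.strictDatum N v).grMk (((g : decomp (K := K) v) : absoluteGaloisGroup K) • t) -
        (Castella2018.AcSelmer.strictDatum N v).grMk t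
    rw [← map_sub]
    exact congrArg _ h1

end Cohomology

section KernelModule

open Field Literature.NumberTheory.EllipticCurves Literature.NumberTheory.EllipticCurves.GreenbergSelmer
  Literature.NumberTheory.GaloisRepresentations NumberField IsDedekindDomain WeierstrassCurve
  Literature.NumberTheory.EllipticCurves.IsogenySelmerInfty

variable {K : Type u} [Field K] {W W' : WeierstrassCurve K} [W.IsElliptic] (p : ℕ) (ψ : Isogeny W W')
  {S : Type u} [AddCommGroup S] [DistribMulAction (absoluteGaloisGroup K) S] [TopologicalSpace S] [DiscreteTopology S]
  (ι : S →+ ↥(geomPrimaryTorsion W p)) (hι : ∀ (σ : absoluteGaloisGroup K) (s : S), ι (σ • s) = σ • ι s)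

omit [W.IsElliptic] in
/-- An element of the kernel of an isogeny of degree `p` is killed by `p` (`#ker ψ = deg ψ = p`, Lagrange).
[cite: SilvermanAEC2009, Thm. III.4.10 (a)] -/
theorem nsmul_eq_zero_of_isogeny_apply_eq_zero (hdeg : ψ.degree = p) {P : W.geomPoints} (hP : ψ P = 0) :
    p • P = 0 := by
  have hmem : P ∈ ψ.toAddMonoidHom.ker := by rwa [AddMonoidHom.mem_ker, Isogeny.coe_toAddMonoidHom]
  have h : Nat.card ψ.toAddMonoidHom.ker • (⟨P, hmem⟩ : ψ.toAddMonoidHom.ker) = 0 := card_nsmul_eq_zero'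
  have hcard : Nat.card ψ.toAddMonoidHom.ker = p := hdeg
  rw [hcard] at h
  have h' := congrArg (fun y : ψ.toAddMonoidHom.ker ↦ (y : W.geomPoints)) h
  simpa only [AddSubgroupClass.coe_nsmul, ZeroMemClass.coe_zero] using h'

/-- **(R1) cocycle lift.** For an isogeny `ψ : W → W'` of degree `p` and `ι : S ↪ W[p^∞]` injective, equivariant, with image
`ker ψ ∩ W[p^∞]`: every class of `H¹(H, W[p^∞])` killed by `ψ_*` is `ι_*` of a class of `H¹(H, S)`. (On cocycles: `ψ ∘ a = ∂v'`;
`ψ` is surjective on `K̄`-points, `v' = ψ(P)` with `P ∈ W[p^∞]` since `deg ψ = p`; `a − ∂P` is `ker ψ`-valued, so it lifts along `ι`.)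
No `μ = 0`, no duality. [cite: SilvermanAEC2009, Thm. II.2.3, Thm. III.4.10] [cite: SerreGaloisCohomology1997, I.§2.4] -/
theorem exists_resH1Hom_eq_of_h1Map_eq_zero [W'.IsElliptic] (hinj : Function.Injective ι)
    (hsurj : ∀ a : geomPrimaryTorsion W p, ψ (a : W.geomPoints) = 0 → ∃ s : S, ι s = a)
    (hdeg : ψ.degree = p) (H : Subgroup (absoluteGaloisGroup K)) (c : W.subgroupH1 p H)
    (hc : h1Map p H ψ.toAddMonoidHom ψ.equivariant c = 0) :
    ∃ d : subgroupH1 H S, resH1Hom (ContinuousMonoidHom.id H) ι (fun x s ↦ hι x s) d = c := by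
  classical
  obtain ⟨a, rfl⟩ := oneCocycleClass_surjective _ c
  rw [h1Map_oneCocycleClass, oneCocycleClass_eq_zero_iff] at hc
  obtain ⟨v', hv'⟩ := hc
  -- lift `v'` through the surjection `ψ : W(K̄) → W'(K̄)`
  obtain ⟨P, hP⟩ := ψ.surjective (v' : W'.geomPoints)
  obtain ⟨k, hk⟩ := v'.2
  have hPk : p ^ (k + 1) • P = 0 := by
    have hker : ψ (p ^ k • P) = 0 := by
      rw [← Isogeny.coe_toAddMonoidHom, map_nsmul, Isogeny.coe_toAddMonoidHom, hP]
      exact hk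
    rw [pow_succ, mul_comm, mul_smul]
    exact nsmul_eq_zero_of_isogeny_apply_eq_zero p ψ hdeg hker
  let b : geomPrimaryTorsion W p := ⟨P, k + 1, hPk⟩
  have hfb : primaryTorsionMap p ψ.toAddMonoidHom b = v' := Subtype.ext (by
    rw [coe_primaryTorsionMap_apply, Isogeny.coe_toAddMonoidHom]; exact hP)
  -- `a' := a − ∂b` is valued in `ker ψ`
  have hcont : Continuous fun g : H ↦ g • b := by
    change Continuous ((fun σ : absoluteGaloisGroup K ↦ σ • b) ∘ ((↑) : H → absoluteGaloisGroup K))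
    exact (continuous_smul_geomPrimaryTorsion W p b).comp continuous_subtype_val
  set a' : contOneCocycles (discreteTopRep H ↥(geomPrimaryTorsion W p)) := a - cobCocycle b hcont with ha'
  have hval : ∀ x : H, primaryTorsionMap p ψ.toAddMonoidHom (a'.1 x) = 0 := by
    intro x
    have h2 := hv' x
    rw [contOneCocycles.push_apply] at h2
    have e1 : a'.1 x = a.1 x - ((x : absoluteGaloisGroup K) • b - b) := rfl
    rw [e1, map_sub, map_sub, h2, primaryTorsionMap_smul p ψ.toAddMonoidHom ψ.equivariant, hfb]
    exact sub_self _
  have hmem : ∀ x : H, ∃ s : S, ι s = a'.1 x := fun x ↦ hsurj (a'.1 x) (by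
    have h3 := congrArg (fun y : geomPrimaryTorsion W' p ↦ (y : W'.geomPoints)) (hval x)
    simpa [coe_primaryTorsionMap_apply] using h3)
  choose s hs using hmem
  refine ⟨oneCocycleClass _ (contOneCocycles.lift ι (fun x t ↦ hι x t) hinj a' s hs), ?_⟩
  rw [resH1Hom_id_oneCocycleClass, contOneCocycles.push_lift, ha', oneCocycleClass_sub, oneCocycleClass_cobCocycle,
    sub_zero]

variable [NumberField K]

/-- **(R4) unramified away from `p`.** At a place `u ∤ p` of good reduction, a class `d ∈ H¹(H, S)` whose image `ι_* d` is
locally trivial at the chosen place above `u` is unramified there: on `H ⊓ I_u` the cocycle is `ι⁻¹(x • a − a)` with `a ∈ W[p^∞]`,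
and inertia at `u` fixes `W[p^∞]` (Néron–Ogg–Shafarevich VII.4.1 (a), forward direction, tree `smul_eq_of_mem_inertia_of_nsmul_eq_zero`).
[cite: SilvermanAEC2009, Prop. VII.4.1 (a)] [cite: GreenbergVatsal2000, §2 p. 26] -/
theorem mem_unramifiedKer_of_resH1Hom_mem_awayKer (hinj : Function.Injective ι) (H : Subgroup (absoluteGaloisGroup K))
    {u : HeightOneSpectrum (𝓞 K)} (hu : W.HasGoodReductionAt u) (hpu : ((p : ℕ) : 𝓞 K) ∉ u.asIdeal)
    (d : subgroupH1 H S)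
    (hd : resH1Hom (ContinuousMonoidHom.id H) ι (fun x s ↦ hι x s) d ∈ awayKer H ↥(geomPrimaryTorsion W p) u) :
    d ∈ GreenbergVatsal2000.unramifiedKer H S u := by
  obtain ⟨z, rfl⟩ := oneCocycleClass_surjective _ d
  rw [awayKer, AddMonoidHom.mem_ker, resOfLe_resH1Hom_id_oneCocycleClass_eq_zero_iff] at hd
  obtain ⟨a, ha⟩ := hd
  rw [GreenbergVatsal2000.unramifiedKer, AddMonoidHom.mem_ker, CocycleCriteria.resH1Hom_oneCocycleClass_eq_zero_iff]
  refine ⟨0, fun x ↦ ?_⟩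
  rw [smul_zero, sub_zero, AddMonoidHom.id_apply]
  obtain ⟨k, hk⟩ := a.2
  have hx := (mem_inertiaIn_iff H u _).1 x.2
  have hI : ((x : decomp (K := K) u) : absoluteGaloisGroup K) ∈
      (adicCompletionPrime K u).inertia (absoluteGaloisGroup K) := by
    rw [inertia_adicCompletionPrime_eq_map_absInertia]; exact hx.2
  have hn : ((p ^ k : ℕ) : 𝓞 K) ∉ u.asIdeal := fun h ↦ hpu (u.isPrime.mem_of_pow_mem k (by exact_mod_cast h))
  have htriv : ((x : decomp (K := K) u) : absoluteGaloisGroup K) • a = a := Subtype.ext (by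
    rw [primaryComponent.coe_smul]
    exact W.smul_eq_of_mem_inertia_of_nsmul_eq_zero hu hn (adicCompletionPrime_mem_primesAbove K u) hI hk)
  have key := ha ⟨((x : decomp (K := K) u) : absoluteGaloisGroup K), Subgroup.mem_inf.2 ⟨hx.1, (x : decomp u).2⟩⟩
  have key' : ι (z.1 (inertiaInToH H u x)) = 0 := by
    refine key.trans ?_
    change ((x : decomp (K := K) u) : absoluteGaloisGroup K) • a - a = 0
    rw [htriv, sub_self]
  exact hinj (by rw [key', map_zero])

end KernelModule

section Generator

open Field Literature.NumberTheory.EllipticCurves Literature.NumberTheory.EllipticCurves.GreenbergSelmer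
  Literature.NumberTheory.GaloisRepresentations NumberField IsDedekindDomain

/-- **(R2) `Γ_K = I_v̄ · ker κ` for the cyclotomic `ℤ_p`-extension at a split prime.** `K` quadratic, `p = v v̄` split, `κ` cyclotomic:
every `σ ∈ Γ_K` is `τ · h` with `τ` in the inertia group of the chosen prime above `v̄` (so `τ ∈ D_v̄`) and `h ∈ ker κ` — take `τ ∈ I_v̄`
with `χ_p(τ) = χ_p(σ)` (`χ_p(I_v̄) = ℤ_pˣ`, tree `exists_mem_inertia_cyclotomicCharacter_eq_of_split`); then `χ_p(τ⁻¹σ) = 1` is torsion,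
i.e. `τ⁻¹σ ∈ ker κ = χ_p⁻¹(μ)`. Hence ONE place of `K_∞` above `v̄` and the `⨅_σ conj_σ` in the Selmer conditions at `v̄` collapses
(`forall_conjH1_mem_awayKer_of_mem`). [cite: NeukirchANT1999, Ch. II (7.13)] [cite: Washington1997, §13.1] -/
theorem exists_mem_decomp_inv_mul_mem_kerSubgroup {K : Type} [Field K] [NumberField K] (hK2 : Module.finrank ℚ K = 2)
    {p : ℕ} [Fact p.Prime] {v vbar : HeightOneSpectrum (𝓞 K)} (hpv : ((p : ℕ) : 𝓞 K) ∈ v.asIdeal)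
    (hpvbar : ((p : ℕ) : 𝓞 K) ∈ vbar.asIdeal) (hne : vbar ≠ v) (κ : ZpExtension K p) (hκ : κ.IsCyclotomic)
    (σ : absoluteGaloisGroup K) : ∃ d ∈ decomp vbar, d⁻¹ * σ ∈ κ.kerSubgroup := by
  obtain ⟨τ, hτI, hτχ⟩ := ZpExtension.exists_mem_inertia_cyclotomicCharacter_eq_of_split hK2 hpv hpvbar hne
    (adicCompletionPrime_mem_primesAbove K vbar) (GaloisRep.cyclotomicCharacter K p σ)
  refine ⟨τ, ?_, ?_⟩
  · have hτ' : τ ∈ inertia vbar := by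
      rw [inertia_adicCompletionPrime_eq_map_absInertia] at hτI; exact hτI
    exact inertia_le_decomp vbar hτ'
  · rw [hκ]
    refine Subgroup.mem_comap.mpr ?_
    change GaloisRep.cyclotomicCharacter K p (τ⁻¹ * σ) ∈ CommGroup.torsion ℤ_[p]ˣ
    rw [map_mul, map_inv, hτχ, inv_mul_cancel]
    exact one_mem _

end Generator

section LocalKernel

open Field Literature.NumberTheory.EllipticCurves Literature.NumberTheory.EllipticCurves.GreenbergSelmer
  Literature.NumberTheory.GaloisRepresentations NumberField IsDedekindDomain WeierstrassCurve
  Literature.NumberTheory.EllipticCurves.IsogenySelmerInfty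

/-- The invariants `A^{G₀}` of a subgroup `G₀` as an additive subgroup. [folklore] -/
def invariants {Γ : Type*} [Group Γ] (A : Type*) [AddCommGroup A] [DistribMulAction Γ A] (G₀ : Subgroup Γ) :
    AddSubgroup A where
  carrier := {a | ∀ x : G₀, (x : Γ) • a = a}
  add_mem' ha hb := fun x ↦ by rw [smul_add, ha x, hb x]
  zero_mem' := fun x ↦ smul_zero _
  neg_mem' ha := fun x ↦ by rw [smul_neg, ha x]

/-- Unfolding `invariants`. [folklore] -/
theorem mem_invariants_iff {Γ : Type*} [Group Γ] {A : Type*} [AddCommGroup A] [DistribMulAction Γ A] {G₀ : Subgroup Γ}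
    {a : A} : a ∈ invariants A G₀ ↔ ∀ x : G₀, (x : Γ) • a = a := Iff.rfl

variable {K : Type u} [Field K] {W W' : WeierstrassCurve K} (p : ℕ) (ψ : Isogeny W W')
  {S : Type u} [AddCommGroup S] [DistribMulAction (absoluteGaloisGroup K) S] [TopologicalSpace S] [DiscreteTopology S]
  (ι : S →+ ↥(geomPrimaryTorsion W p)) (hι : ∀ (σ : absoluteGaloisGroup K) (s : S), ι (σ • s) = σ • ι s)
  (G₀ : Subgroup (absoluteGaloisGroup K))

omit [DistribMulAction (absoluteGaloisGroup K) S] [TopologicalSpace S] [DiscreteTopology S] in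
/-- For `a ∈ W[p^∞]` with `ψ a` `G₀`-invariant, `x • a − a ∈ ker ψ = ι(S)` for `x ∈ G₀`. [folklore] -/
theorem exists_eq_smul_sub (hsurj : ∀ a : geomPrimaryTorsion W p, ψ (a : W.geomPoints) = 0 → ∃ s : S, ι s = a)
    {a : geomPrimaryTorsion W p}
    (ha : primaryTorsionMap p ψ.toAddMonoidHom a ∈ invariants ↥(geomPrimaryTorsion W' p) G₀) (x : G₀) :
    ∃ s : S, ι s = (x : absoluteGaloisGroup K) • a - a :=
  hsurj _ (by
    have h1 : primaryTorsionMap p ψ.toAddMonoidHom ((x : absoluteGaloisGroup K) • a - a) = 0 := by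
      rw [map_sub, primaryTorsionMap_smul p ψ.toAddMonoidHom ψ.equivariant, ha x, sub_self]
    have h3 := congrArg (fun y : geomPrimaryTorsion W' p ↦ (y : W'.geomPoints)) h1
    simpa [coe_primaryTorsionMap_apply] using h3)

/-- **The connecting cocycle** `x ↦ ι⁻¹(x • a − a) : G₀ → S` of an element `a ∈ W[p^∞]` with `ψ a ∈ W'[p^∞]^{G₀}` (the coboundary
map `W'[p^∞]^{G₀} → H¹(G₀, W[ψ])` of `0 → W[ψ] → W[p^∞] → W'[p^∞] → 0`, evaluated on the lift `a`).
[cite: SerreGaloisCohomology1997, I.§5.4 (connecting map)] [cite: GreenbergLNM1716, §5, proof of Prop. 5.10] -/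
noncomputable def connCocycle (hinj : Function.Injective ι)
    (hsurj : ∀ a : geomPrimaryTorsion W p, ψ (a : W.geomPoints) = 0 → ∃ s : S, ι s = a)
    {a : geomPrimaryTorsion W p} (ha : primaryTorsionMap p ψ.toAddMonoidHom a ∈ invariants ↥(geomPrimaryTorsion W' p) G₀) :
    contOneCocycles (discreteTopRep G₀ S) :=
  contOneCocycles.lift ι (fun x t ↦ hι x t) hinj
    (cobCocycle a (show Continuous fun g : G₀ ↦ g • a by
      change Continuous ((fun σ : absoluteGaloisGroup K ↦ σ • a) ∘ ((↑) : G₀ → absoluteGaloisGroup K))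
      exact (continuous_smul_geomPrimaryTorsion W p a).comp continuous_subtype_val))
    (fun x ↦ (exists_eq_smul_sub p ψ ι G₀ hsurj ha x).choose)
    (fun x ↦ (exists_eq_smul_sub p ψ ι G₀ hsurj ha x).choose_spec)

/-- Values of the connecting cocycle after `ι`. [folklore] -/
theorem apply_connCocycle (hinj : Function.Injective ι)
    (hsurj : ∀ a : geomPrimaryTorsion W p, ψ (a : W.geomPoints) = 0 → ∃ s : S, ι s = a)
    {a : geomPrimaryTorsion W p} (ha : primaryTorsionMap p ψ.toAddMonoidHom a ∈ invariants ↥(geomPrimaryTorsion W' p) G₀)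
    (x : G₀) : ι ((connCocycle p ψ ι hι G₀ hinj hsurj ha).1 x) = (x : absoluteGaloisGroup K) • a - a := by
  rw [connCocycle, contOneCocycles.lift_apply]
  exact (exists_eq_smul_sub p ψ ι G₀ hsurj ha x).choose_spec

/-- **Exactness at `H¹(G₀, W[ψ])`:** a class killed by `ι_*` is a connecting class. [cite: SerreGaloisCohomology1997, I.§5.4 Prop. 38] -/
theorem exists_connCocycle_eq_of_resH1Hom_eq_zero (hinj : Function.Injective ι)
    (hιψ : ∀ s : S, ψ ((ι s : geomPrimaryTorsion W p) : W.geomPoints) = 0)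
    (hsurj : ∀ a : geomPrimaryTorsion W p, ψ (a : W.geomPoints) = 0 → ∃ s : S, ι s = a)
    (f : subgroupH1 G₀ S) (hf : resH1Hom (ContinuousMonoidHom.id G₀) ι (fun x s ↦ hι x s) f = 0) :
    ∃ (a : geomPrimaryTorsion W p) (ha : primaryTorsionMap p ψ.toAddMonoidHom a ∈ invariants ↥(geomPrimaryTorsion W' p) G₀),
      oneCocycleClass _ (connCocycle p ψ ι hι G₀ hinj hsurj ha) = f := by
  obtain ⟨z, rfl⟩ := oneCocycleClass_surjective _ f
  rw [resH1Hom_id_oneCocycleClass, oneCocycleClass_eq_zero_iff] at hf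
  obtain ⟨a, ha⟩ := hf
  have ha' : ∀ x : G₀, ι (z.1 x) = (x : absoluteGaloisGroup K) • a - a := fun x ↦ by
    have h1 := ha x
    rw [contOneCocycles.push_apply] at h1
    exact h1
  have hainv : primaryTorsionMap p ψ.toAddMonoidHom a ∈ invariants ↥(geomPrimaryTorsion W' p) G₀ := by
    intro x
    have h2 : primaryTorsionMap p ψ.toAddMonoidHom ((x : absoluteGaloisGroup K) • a - a) = 0 := by
      rw [← ha' x]
      exact Subtype.ext (by rw [coe_primaryTorsionMap_apply, Isogeny.coe_toAddMonoidHom]; exact hιψ _)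
    rwa [map_sub, primaryTorsionMap_smul p ψ.toAddMonoidHom ψ.equivariant, sub_eq_zero] at h2
  refine ⟨a, hainv, congrArg (oneCocycleClass _) (Subtype.ext (ContinuousMap.ext fun x ↦ hinj ?_))⟩
  rw [apply_connCocycle, ha' x]

/-- **Two lifts with the same image in `W'[p^∞]^{G₀} / ψ(W[p^∞]^{G₀})` give the same connecting class**: if `ψ a₂ = ψ a₁ + ψ b`
with `b` invariant then `a₂ = a₁ + b + ι s₀` and the cocycles differ by `∂ s₀`. [cite: SerreGaloisCohomology1997, I.§5.4] -/
theorem connClass_eq_of_eq_add (hinj : Function.Injective ι)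
    (hsurj : ∀ a : geomPrimaryTorsion W p, ψ (a : W.geomPoints) = 0 → ∃ s : S, ι s = a)
    {a₁ a₂ b : geomPrimaryTorsion W p}
    (ha₁ : primaryTorsionMap p ψ.toAddMonoidHom a₁ ∈ invariants ↥(geomPrimaryTorsion W' p) G₀)
    (ha₂ : primaryTorsionMap p ψ.toAddMonoidHom a₂ ∈ invariants ↥(geomPrimaryTorsion W' p) G₀)
    (hb : b ∈ invariants ↥(geomPrimaryTorsion W p) G₀)
    (h : primaryTorsionMap p ψ.toAddMonoidHom a₂ = primaryTorsionMap p ψ.toAddMonoidHom a₁ + primaryTorsionMap p ψ.toAddMonoidHom b) :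
    oneCocycleClass _ (connCocycle p ψ ι hι G₀ hinj hsurj ha₁) = oneCocycleClass _ (connCocycle p ψ ι hι G₀ hinj hsurj ha₂) := by
  -- `a₂ - a₁ - b ∈ ker ψ = ι(S)`
  obtain ⟨s₀, hs₀⟩ := hsurj (a₂ - a₁ - b) (by
    have h1 : primaryTorsionMap p ψ.toAddMonoidHom (a₂ - a₁ - b) = 0 := by rw [map_sub, map_sub, h]; abel
    have h3 := congrArg (fun y : geomPrimaryTorsion W' p ↦ (y : W'.geomPoints)) h1
    simpa [coe_primaryTorsionMap_apply] using h3)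
  rw [eq_comm, ← sub_eq_zero, ← oneCocycleClass_sub, oneCocycleClass_eq_zero_iff]
  refine ⟨s₀, fun x ↦ hinj ?_⟩
  change ι ((connCocycle p ψ ι hι G₀ hinj hsurj ha₂).1 x - (connCocycle p ψ ι hι G₀ hinj hsurj ha₁).1 x) = ι (x • s₀ - s₀)
  rw [map_sub, map_sub, apply_connCocycle, apply_connCocycle]
  have hb' := hb x
  have hxs : ι (x • s₀) = (x : absoluteGaloisGroup K) • (a₂ - a₁ - b) := by rw [← hs₀]; exact hι x s₀
  rw [hxs, hs₀, smul_sub, smul_sub, hb']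
  abel

/-- **(R3) the local kernel over `v̄` is finite.** For ANY subgroup `G₀ ≤ Γ_K` (intended: `G₀ = ker κ ⊓ D_v̄`), the kernel of
`ι_* : H¹(G₀, W[ψ]) → H¹(G₀, W[p^∞])` is finite: it is the image of `W'[p^∞]^{G₀}` under the connecting map, which factors through
`W'[p^∞]^{G₀} / (ψ(W[p^∞]^{G₀}) ∩ W'[p^∞]^{G₀})`, finite by (R3-alg) (`finiteIndex_map_inf_of_comp_eq_nsmul` with the dual isogeny
`ψ̂`, `ψ̂ψ = [p]`; `W'[p]` finite). NO appeal to Imai's theorem, no `μ`. [cite: GreenbergLNM1716, §5, proof of Prop. 5.10]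
[cite: SilvermanAEC2009, Thm. III.6.1 (a), Cor. III.6.4] -/
theorem finite_ker_resH1Hom_id [NumberField K] [hp : Fact p.Prime] [W.IsElliptic] [W'.IsElliptic]
    (hinj : Function.Injective ι)
    (hιψ : ∀ s : S, ψ ((ι s : geomPrimaryTorsion W p) : W.geomPoints) = 0)
    (hsurj : ∀ a : geomPrimaryTorsion W p, ψ (a : W.geomPoints) = 0 → ∃ s : S, ι s = a) (hdeg : ψ.degree = p) :
    {f : subgroupH1 G₀ S | resH1Hom (ContinuousMonoidHom.id G₀) ι (fun x s ↦ hι x s) f = 0}.Finite := by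
  classical
  -- the dual isogeny and (R3-alg)
  obtain ⟨χ, hχ⟩ := Isogeny.exists_dual_holds_of_isElliptic (W := W) (W' := W') ψ
  set g : ↥(geomPrimaryTorsion W p) →+ ↥(geomPrimaryTorsion W' p) := primaryTorsionMap p ψ.toAddMonoidHom with hg
  set gd : ↥(geomPrimaryTorsion W' p) →+ ↥(geomPrimaryTorsion W p) := primaryTorsionMap p χ.toAddMonoidHom with hgd
  have hcomp : ∀ a' : geomPrimaryTorsion W' p, g (gd a') = p • a' := by
    intro a'
    obtain ⟨Q, hQ⟩ := ψ.surjective (a' : W'.geomPoints)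
    apply Subtype.ext
    rw [hg, hgd, coe_primaryTorsionMap_apply, coe_primaryTorsionMap_apply, AddSubgroupClass.coe_nsmul, ← hQ,
      Isogeny.coe_toAddMonoidHom, Isogeny.coe_toAddMonoidHom, hχ, hdeg, natCast_zsmul, ← Isogeny.coe_toAddMonoidHom,
      map_nsmul]
  have hprim : ∀ a' : geomPrimaryTorsion W' p, ∃ k : ℕ, p ^ k • a' = 0 := fun a' ↦ by
    obtain ⟨k, hk⟩ := a'.2
    exact ⟨k, Subtype.ext (by rw [AddSubgroupClass.coe_nsmul]; exact hk)⟩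
  have hfin := finite_torsionBy_addSubgroup (p := p) (geomPrimaryTorsion W' p)
    (W'.finite_geomTorsion (m := (p : ℤ)) (by exact_mod_cast hp.out.ne_zero))
  set A₀ := invariants ↥(geomPrimaryTorsion W p) G₀ with hA₀
  set A'₀ := invariants ↥(geomPrimaryTorsion W' p) G₀ with hA'₀
  have hgdinv : ∀ a' ∈ A'₀, gd a' ∈ A₀ := fun a' ha' x ↦ by
    rw [hgd, ← primaryTorsionMap_smul p χ.toAddMonoidHom χ.equivariant, ha' x]
  haveI hFI := finiteIndex_map_inf_of_comp_eq_nsmul g gd hcomp hprim hfin A₀ A'₀ hgdinv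
  -- the connecting classes, indexed by lifts, have finitely many values
  let L : Type u := {a : geomPrimaryTorsion W p // g a ∈ A'₀}
  let q : L → A'₀ ⧸ (A₀.map g ⊓ A'₀).addSubgroupOf A'₀ := fun a ↦ QuotientAddGroup.mk ⟨g a, a.2⟩
  let C : L → subgroupH1 G₀ S := fun a ↦ oneCocycleClass _ (connCocycle p ψ ι hι G₀ hinj hsurj a.2)
  have hC : (Set.range C).Finite := by
    have hsub : Set.range C ⊆ ⋃ y, C '' (q ⁻¹' {y}) := by
      rintro _ ⟨a, rfl⟩
      exact Set.mem_iUnion.2 ⟨q a, Set.mem_image_of_mem C rfl⟩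
    refine (Set.finite_iUnion fun y ↦ Set.Subsingleton.finite ?_).subset hsub
    rintro _ ⟨a₁, ha₁, rfl⟩ _ ⟨a₂, ha₂, rfl⟩
    have h12 : q a₁ = q a₂ := (ha₁ : q a₁ = y).trans (ha₂ : q a₂ = y).symm
    have hmem := (QuotientAddGroup.eq (s := (A₀.map g ⊓ A'₀).addSubgroupOf A'₀)).1 h12
    rw [AddSubgroup.mem_addSubgroupOf, AddSubgroup.mem_inf] at hmem
    obtain ⟨⟨b, hb, hgb⟩, -⟩ := hmem
    refine connClass_eq_of_eq_add p ψ ι hι G₀ hinj hsurj a₁.2 a₂.2 hb ?_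
    change g a₂ = g a₁ + g b
    rw [hgb]
    change g a₂ = g a₁ + (-g a₁ + g a₂)
    abel
  refine hC.subset fun f hf ↦ ?_
  obtain ⟨a, ha, h⟩ := exists_connCocycle_eq_of_resH1Hom_eq_zero p ψ ι hι G₀ hinj hιψ hsurj f hf
  exact ⟨⟨a, ha⟩, h⟩

end LocalKernel

section Assembly

open Field Literature.NumberTheory.EllipticCurves Literature.NumberTheory.EllipticCurves.GreenbergSelmer
  Literature.NumberTheory.GaloisRepresentations NumberField IsDedekindDomain WeierstrassCurve
  Literature.NumberTheory.EllipticCurves.IsogenySelmerInfty Literature.NumberTheory.EllipticCurves.Castella2018.AcSelmer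

variable {K : Type} [Field K] [NumberField K] {W W' : WeierstrassCurve K} [W.IsElliptic] [W'.IsElliptic]
  (p : ℕ) [hp : Fact p.Prime] (ψ : Isogeny W W')
  {S : Type} [AddCommGroup S] [DistribMulAction (absoluteGaloisGroup K) S] [TopologicalSpace S] [DiscreteTopology S]
  (ι : S →+ ↥(geomPrimaryTorsion W p))

/-- **(R5)/(R6) Road B residue, abstract kernel module.** `K` quadratic, `p = v v̄` split, `κ` the cyclotomic `ℤ_p`-extension,
`ψ : W → W'` a `K`-isogeny of degree `p` of elliptic curves, `ι : S ↪ W[p^∞]` injective equivariant with image `W[ψ]`. IF the residual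
Greenberg-strict Selmer group `Sel^{str}_{v̄}(K_∞, S)` (unramified outside `p` and the bad places of `W`, locally trivial above `v̄` —
the instance of `ResidualGL1FinitenessOdd` for `M = S`) is finite, THEN the classes of Castella's `Sel_{v̄}(K_∞, W[p^∞])` killed by `ψ_*`
form a finite set. Proof = memo §10: (R1) each such class is `ι_* d`; the `d` with `ι_* d ∈ Sel` form a subgroup `T`; (R4)+(R2) `T ∩
(loc. trivial above v̄) ⊆ Sel^{str}_{v̄}(K_∞, S)` (finite); (R3) restriction to `ker κ ⊓ D_v̄` maps `T` into the finite local kernel; a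
group with finite kernel-part and finite image is finite. No `μ = 0` input (Drinen/Matsuno unboundedness is not contradicted: the bound is
by `#Sel^{str}(K_∞, W[ψ])`, a GL₁ main-conjecture quantity). [cite: GreenbergVatsal2000, §2 pp. 23–27 (proof of Prop. 2.8)]
[cite: GreenbergLNM1716, §5 Prop. 5.10] [cite: Castella2018, Def. 2.2] -/
theorem finite_selmerAc_inter_ker_h1Map (hι : ∀ (σ : absoluteGaloisGroup K) (s : S), ι (σ • s) = σ • ι s)
    (hinj : Function.Injective ι)
    (hιψ : ∀ s : S, ψ ((ι s : geomPrimaryTorsion W p) : W.geomPoints) = 0)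
    (hsurj : ∀ a : geomPrimaryTorsion W p, ψ (a : W.geomPoints) = 0 → ∃ s : S, ι s = a) (hdeg : ψ.degree = p)
    (hK2 : Module.finrank ℚ K = 2) {v vbar : HeightOneSpectrum (𝓞 K)} (hpv : ((p : ℕ) : 𝓞 K) ∈ v.asIdeal)
    (hpvbar : ((p : ℕ) : 𝓞 K) ∈ vbar.asIdeal) (hne : vbar ≠ v) (κ : ZpExtension K p) (hκ : κ.IsCyclotomic)
    (hR : (GreenbergVatsal2000.datumStrictSelmer κ.kerSubgroup S p (bdpData S p vbar) (W.badPlaces (𝓞 K)) :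
      Set (subgroupH1 κ.kerSubgroup S)).Finite) :
    {c : W.subgroupH1 p κ.kerSubgroup |
      c ∈ selmerAc W p κ vbar ∅ ∧ h1Map p κ.kerSubgroup ψ.toAddMonoidHom ψ.equivariant c = 0}.Finite := by
  classical
  -- `ι_*` on `H¹(ker κ, ·)` and the subgroup `T` of classes landing in `Sel`
  let ιH : subgroupH1 κ.kerSubgroup S →+ W.subgroupH1 p κ.kerSubgroup :=
    resH1Hom (ContinuousMonoidHom.id κ.kerSubgroup) ι (fun x s ↦ hι x s)
  let T : AddSubgroup (subgroupH1 κ.kerSubgroup S) := (selmerAc W p κ vbar ∅).comap ιH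
  -- (R1): every kernel class is `ι_*` of an element of `T`
  have hcover : {c : W.subgroupH1 p κ.kerSubgroup |
      c ∈ selmerAc W p κ vbar ∅ ∧ h1Map p κ.kerSubgroup ψ.toAddMonoidHom ψ.equivariant c = 0} ⊆ ιH '' (T : Set _) := by
    rintro c ⟨hc, hc0⟩
    obtain ⟨d, rfl⟩ := exists_resH1Hom_eq_of_h1Map_eq_zero p ψ ι hι hinj hsurj hdeg κ.kerSubgroup c hc0
    exact ⟨d, AddSubgroup.mem_comap.2 hc, rfl⟩
  suffices hTfin : ((T : AddSubgroup (subgroupH1 κ.kerSubgroup S)) : Set (subgroupH1 κ.kerSubgroup S)).Finite from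
    (hTfin.image ιH).subset hcover
  -- (R4)+(R2): `T ∩ (locally trivial above v̄) ⊆ Sel^{str}`
  have hgen := exists_mem_decomp_inv_mul_mem_kerSubgroup hK2 hpv hpvbar hne κ hκ
  have hTR : ∀ d ∈ T, d ∈ awayKer κ.kerSubgroup S vbar →
      d ∈ GreenbergVatsal2000.datumStrictSelmer κ.kerSubgroup S p (bdpData S p vbar) (W.badPlaces (𝓞 K)) := by
    intro d hdT hdv
    have hsel : ιH d ∈ selmerAc W p κ vbar ∅ := AddSubgroup.mem_comap.1 hdT
    rw [selmerAc, mem_selmerOver_iff] at hsel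
    rw [GreenbergVatsal2000.mem_datumStrictSelmer_iff]
    refine ⟨?_, fun u hu σ ↦ ?_⟩
    · rw [GreenbergVatsal2000.mem_unramifiedOutside_iff]
      intro u huS hpu σ
      have hu : W.HasGoodReductionAt u := by
        by_contra hbad
        exact huS hbad
      have h1 := hsel.1 u hpu (Set.notMem_empty u) σ
      have h2 : ιH (conjH1 κ.kerSubgroup S σ d) ∈ awayKer κ.kerSubgroup ↥(geomPrimaryTorsion W p) u := by
        have e := resH1Hom_id_conjH1 κ.kerSubgroup ι hι σ d
        change ιH (conjH1 κ.kerSubgroup S σ d) = conjH1 κ.kerSubgroup _ σ (ιH d) at e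
        rw [e]
        exact h1
      exact mem_unramifiedKer_of_resH1Hom_mem_awayKer p ι hι hinj κ.kerSubgroup hu hpu _ h2
    · by_cases huv : u = vbar
      · subst huv
        rw [bdpData_self, strictKer_strictDatum_eq_awayKer']
        exact forall_conjH1_mem_awayKer_of_mem κ.kerSubgroup S hgen hdv σ
      · rw [bdpData_of_ne _ _ hu huv, strictKer_relaxedDatum_eq_top]
        exact AddSubgroup.mem_top _
  have hKfin : {d : subgroupH1 κ.kerSubgroup S | d ∈ T ∧ d ∈ awayKer κ.kerSubgroup S vbar}.Finite :=
    hR.subset fun d hd ↦ hTR d hd.1 hd.2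
  -- (R3): restriction to `G₀ = ker κ ⊓ D_v̄` maps `T` into the finite local kernel
  have hres : ∀ d ∈ T, resH1Hom (ContinuousMonoidHom.id ↥(κ.kerSubgroup ⊓ decomp vbar)) ι (fun x s ↦ hι x s)
      (resOfLe S (inf_le_left : κ.kerSubgroup ⊓ decomp vbar ≤ κ.kerSubgroup) d) = 0 := by
    intro d hdT
    have hsel : ιH d ∈ selmerAc W p κ vbar ∅ := AddSubgroup.mem_comap.1 hdT
    rw [selmerAc, mem_selmerOver_iff] at hsel
    have h1 := hsel.2.2 1
    rw [Literature.NumberTheory.EllipticCurves.conjH1_one_holds κ.kerSubgroup, AddMonoidHom.id_apply, strictKer_strictDatum_eq_awayKer', awayKer, AddMonoidHom.mem_ker] at h1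
    rw [← resOfLe_resH1Hom_id (inf_le_left : κ.kerSubgroup ⊓ decomp vbar ≤ κ.kerSubgroup) ι hι d]
    exact h1
  -- finite kernel-part and finite image ⇒ `T` finite (cosets of `T ∩ ker` indexed by the image)
  let g : subgroupH1 κ.kerSubgroup S →+ subgroupH1 (κ.kerSubgroup ⊓ decomp vbar) S :=
    resOfLe S (inf_le_left : κ.kerSubgroup ⊓ decomp vbar ≤ κ.kerSubgroup)
  have hIm : (g '' (T : Set (subgroupH1 κ.kerSubgroup S))).Finite :=
    (finite_ker_resH1Hom_id p ψ ι hι (κ.kerSubgroup ⊓ decomp vbar) hinj hιψ hsurj hdeg).subset (by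
      rintro _ ⟨d, hd, rfl⟩
      exact hres d hd)
  have hK0 : {k : subgroupH1 κ.kerSubgroup S | k ∈ T ∧ g k = 0}.Finite :=
    hKfin.subset fun k hk ↦ ⟨hk.1, by rw [awayKer, AddMonoidHom.mem_ker]; exact hk.2⟩
  let pre : subgroupH1 (κ.kerSubgroup ⊓ decomp vbar) S → subgroupH1 κ.kerSubgroup S := fun y ↦
    if hy : y ∈ g '' (T : Set (subgroupH1 κ.kerSubgroup S)) then hy.choose else 0
  have hpre : ∀ y ∈ g '' (T : Set (subgroupH1 κ.kerSubgroup S)), pre y ∈ T ∧ g (pre y) = y := by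
    intro y hy
    have e : pre y = hy.choose := dif_pos hy
    rw [e]
    exact hy.choose_spec
  refine (hIm.biUnion fun y _ ↦ hK0.image fun k ↦ pre y + k).subset fun d hd ↦ ?_
  have hy : g d ∈ g '' (T : Set (subgroupH1 κ.kerSubgroup S)) := Set.mem_image_of_mem g hd
  refine Set.mem_biUnion hy ⟨d - pre (g d), ⟨T.sub_mem hd (hpre _ hy).1, ?_⟩, ?_⟩
  · rw [map_sub, (hpre _ hy).2, sub_self]
  · change pre (g d) + (d - pre (g d)) = d
    abel

end Assembly

section Instantiation

open Field Literature.NumberTheory.EllipticCurves Literature.NumberTheory.EllipticCurves.GreenbergSelmer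
  Literature.NumberTheory.GaloisRepresentations NumberField IsDedekindDomain WeierstrassCurve
  Literature.NumberTheory.EllipticCurves.IsogenySelmerInfty Literature.NumberTheory.EllipticCurves.Castella2018.AcSelmer

/-- For `ι : k̄ ≃ₐ[k] F̄` lifting the chosen embedding, `ι⁻¹ ∘ σ ∘ ι = res σ` for `σ ∈ Γ_F`. Local copy (with attribution) of the
Summits-side `toAlgEquiv_symm_conj_eq_absGaloisRestrict` (ErratumRoadFiveTateTorsionRigidityPadicModel §2), to keep the imports of
this workfile inside Literature. [cite: MilneFT2022, Ch. 7 (restriction to the absolute Galois group of a subfield)] -/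
theorem toAlgEquiv_symm_conj_eq_absGaloisRestrict' {k : Type u} [Field k] (F : Type u) [Field F] [Algebra k F]
    (ι : AlgebraicClosure k ≃ₐ[k] AlgebraicClosure F) (hι : ∀ x, ι x = absClosureEmbedding k F x)
    (σ : absoluteGaloisGroup F) :
    (absoluteGaloisGroup.toAlgEquiv k).symm
        (ι.trans ((AlgEquiv.restrictScalars k
          (absoluteGaloisGroup.toAlgEquiv F σ : AlgebraicClosure F ≃ₐ[F] AlgebraicClosure F)).trans ι.symm)) =
      absGaloisRestrict k F σ := by
  apply (absoluteGaloisGroup.toAlgEquiv k).injective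
  rw [MulEquiv.apply_symm_apply]
  ext x
  apply ι.injective
  change ι (ι.symm (absoluteGaloisGroup.toAlgEquiv F σ (ι x))) = ι (absGaloisRestrict k F σ • x)
  rw [ι.apply_symm_apply, hι, hι, absGaloisRestrict_apply_smul]
  rfl

/-- **Transport of points along the chosen `k̄ ≃ F̄` is `res`-equivariant**: `ι_* (res σ • P) = σ • ι_* P`. Local copy of the
Summits-side `geomPointsExtend_absGaloisRestrict_smul`. [cite: SerreGaloisCohomology1997, I.§2.4 (compatible pairs)] -/
theorem geomPointsExtend_absGaloisRestrict_smul' {k : Type u} [Field k] (W₀ : WeierstrassCurve k) (F : Type u) [Field F]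
    [Algebra k F] (ι : AlgebraicClosure k ≃ₐ[k] AlgebraicClosure F) (hι : ∀ x, ι x = absClosureEmbedding k F x)
    (σ : absoluteGaloisGroup F) (P : W₀.geomPoints) :
    W₀.geomPointsExtend F ι (absGaloisRestrict k F σ • P) = σ • W₀.geomPointsExtend F ι P := by
  rw [← toAlgEquiv_symm_conj_eq_absGaloisRestrict' F ι hι σ]
  exact geomPointsExtend_smul ι σ P

variable {W W' : WeierstrassCurve ℚ} (p : ℕ) (ψ₀ : Isogeny W W') (K : Type) [Field K] [NumberField K]

/-- **The residual module `E[ψ₀]` as a `Γ_K`-module** through `res : Γ_K → Γ_ℚ` (`E[ψ₀] ⊆ E(ℚ̄)` with `Isogeny.kerAction`). A `def`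
of class type (supplied by `letI`), reducible as Lean requires. This is the `M` of `ResidualGL1FinitenessOdd` for Road B, with the
compatibility `σ • m = res σ • m` holding by `rfl`. [cite: SilvermanAEC2009, X.§4 (Thm. X.4.2, the module `E[φ]`)] -/
noncomputable abbrev kerResAction : DistribMulAction (absoluteGaloisGroup K) ↥ψ₀.toAddMonoidHom.ker :=
  letI := ψ₀.kerAction
  DistribMulAction.compHom ↥ψ₀.toAddMonoidHom.ker (absGaloisRestrict ℚ K).toMonoidHom

/-- `E[ψ₀]` is killed by `p = deg ψ₀`, so its transport lies in `E_K[p^∞]`. [cite: SilvermanAEC2009, Thm. III.4.10 (a)] -/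
theorem geomPointsExtend_ker_mem (hdeg : ψ₀.degree = p) (P : ↥ψ₀.toAddMonoidHom.ker) :
    W.geomPointsExtend K (Literature.NumberTheory.GaloisRepresentations.absClosureEquiv ℚ K) (P : W.geomPoints) ∈ geomPrimaryTorsion (W.baseChange K) p := by
  refine ⟨1, ?_⟩
  have hP : ψ₀ (P : W.geomPoints) = 0 := by
    have h := P.2
    rwa [AddMonoidHom.mem_ker, Isogeny.coe_toAddMonoidHom] at h
  rw [pow_one, ← map_nsmul, nsmul_eq_zero_of_isogeny_apply_eq_zero p ψ₀ hdeg hP, map_zero]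

/-- **`ι : E[ψ₀] → E_K[p^∞]`**, `P ↦ ι_* P` (transport along the chosen `ℚ̄ ≃ K̄`). [cite: SilvermanAEC2009, III.§2, X.§4] -/
noncomputable def kerToPrimary (hdeg : ψ₀.degree = p) :
    ↥ψ₀.toAddMonoidHom.ker →+ ↥(geomPrimaryTorsion (W.baseChange K) p) where
  toFun P := ⟨W.geomPointsExtend K (Literature.NumberTheory.GaloisRepresentations.absClosureEquiv ℚ K) (P : W.geomPoints), geomPointsExtend_ker_mem p ψ₀ K hdeg P⟩
  map_zero' := Subtype.ext (by simp)
  map_add' P Q := Subtype.ext (by simp)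

/-- Unfolding `kerToPrimary`. [folklore] -/
theorem coe_kerToPrimary_apply (hdeg : ψ₀.degree = p) (P : ↥ψ₀.toAddMonoidHom.ker) :
    ((kerToPrimary p ψ₀ K hdeg P : geomPrimaryTorsion (W.baseChange K) p) : (W.baseChange K).geomPoints) =
      W.geomPointsExtend K (Literature.NumberTheory.GaloisRepresentations.absClosureEquiv ℚ K) (P : W.geomPoints) :=
  rfl

/-- `ι` is `Γ_K`-equivariant for the action through `res`. [cite: SerreGaloisCohomology1997, I.§2.4] -/
theorem kerToPrimary_smul (hdeg : ψ₀.degree = p) (σ : absoluteGaloisGroup K) (P : ↥ψ₀.toAddMonoidHom.ker) :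
    letI := kerResAction ψ₀ K
    kerToPrimary p ψ₀ K hdeg (σ • P) = σ • kerToPrimary p ψ₀ K hdeg P := by
  letI := kerResAction ψ₀ K
  apply Subtype.ext
  rw [coe_kerToPrimary_apply, primaryComponent.coe_smul, coe_kerToPrimary_apply]
  exact geomPointsExtend_absGaloisRestrict_smul' W K (Literature.NumberTheory.GaloisRepresentations.absClosureEquiv ℚ K) (Literature.NumberTheory.GaloisRepresentations.absClosureEquiv_apply ℚ K) σ P

/-- `ι` is injective. [folklore] -/
theorem kerToPrimary_injective (hdeg : ψ₀.degree = p) : Function.Injective (kerToPrimary p ψ₀ K hdeg) := by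
  intro P Q h
  have h' := congrArg (fun y : geomPrimaryTorsion (W.baseChange K) p ↦ (y : (W.baseChange K).geomPoints)) h
  simp only [coe_kerToPrimary_apply] at h'
  exact Subtype.ext ((W.geomPointsExtend K (Literature.NumberTheory.GaloisRepresentations.absClosureEquiv ℚ K)).injective h')

/-- `ψ₀,K ∘ ι = 0`. [cite: SilvermanAEC2009, III.§4 (p. 66)] -/
theorem extendScalars_kerToPrimary (hdeg : ψ₀.degree = p) (P : ↥ψ₀.toAddMonoidHom.ker) :
    ψ₀.extendScalars K ((kerToPrimary p ψ₀ K hdeg P : geomPrimaryTorsion (W.baseChange K) p) :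
      (W.baseChange K).geomPoints) = 0 := by
  have hP : ψ₀ (P : W.geomPoints) = 0 := by
    have h := P.2
    rwa [AddMonoidHom.mem_ker, Isogeny.coe_toAddMonoidHom] at h
  rw [coe_kerToPrimary_apply, Isogeny.extendScalars, Isogeny.extendScalarsOfAlgEquiv_apply_geomPointsExtend, hP, map_zero]

/-- The image of `ι` is `E_K[ψ₀,K] ∩ E_K[p^∞]` (indeed all of `E_K[ψ₀,K]`). [cite: SilvermanAEC2009, III.§4 (p. 66)] -/
theorem exists_kerToPrimary_eq (hdeg : ψ₀.degree = p) (a : geomPrimaryTorsion (W.baseChange K) p)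
    (ha : ψ₀.extendScalars K (a : (W.baseChange K).geomPoints) = 0) : ∃ P, kerToPrimary p ψ₀ K hdeg P = a := by
  set Q := (W.geomPointsExtend K (Literature.NumberTheory.GaloisRepresentations.absClosureEquiv ℚ K)).symm (a : (W.baseChange K).geomPoints) with hQ
  have haQ : (a : (W.baseChange K).geomPoints) = W.geomPointsExtend K (Literature.NumberTheory.GaloisRepresentations.absClosureEquiv ℚ K) Q := by
    rw [hQ, AddEquiv.apply_symm_apply]
  have hQker : Q ∈ ψ₀.toAddMonoidHom.ker := by
    rw [haQ, Isogeny.extendScalars, Isogeny.extendScalarsOfAlgEquiv_apply_geomPointsExtend,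
      AddEquiv.map_eq_zero_iff] at ha
    rwa [AddMonoidHom.mem_ker, Isogeny.coe_toAddMonoidHom]
  exact ⟨⟨Q, hQker⟩, Subtype.ext (by rw [coe_kerToPrimary_apply, haQ])⟩

/-- **Road B residue for `E[ψ₀]`, `deg ψ₀ = p`** — the companion's form of the owed main-file theorem `roadB_residue_p :
RoadBResidueP`: for `W, W'/ℚ` elliptic, `ψ₀ : W → W'` a `ℚ`-isogeny of degree `p`, `K` quadratic with `p = v v̄` split, `κ` cyclotomic,
IF the residual strict Selmer group of the `Γ_K`-module `E[ψ₀]` (strict above `v̄`, unramified outside `p` and the bad places of `W_K`;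
the `M := E[ψ₀]`, `S := bad places` instance of `ResidualGL1FinitenessOdd`) is finite THEN the classes of Castella's
`Sel_{v̄}(K_∞, W_K[p^∞])` killed by `(ψ₀,K)_*` form a finite set; the main file's `K2e.acSelmerMap … ψ₀,K` has kernel injecting into
this set by `c ↦ (c : H¹)` (`K2e.coe_acSelmerMap_apply`). [cite: GreenbergVatsal2000, §2 (proof of Prop. 2.8)]
[cite: GreenbergLNM1716, §5 Prop. 5.10] -/
theorem finite_selmerAc_inter_ker_h1Map_extendScalars [W.IsElliptic] [W'.IsElliptic] [Fact p.Prime]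
    (hdeg : ψ₀.degree = p) (hK2 : Module.finrank ℚ K = 2) {v vbar : HeightOneSpectrum (𝓞 K)}
    (hpv : ((p : ℕ) : 𝓞 K) ∈ v.asIdeal) (hpvbar : ((p : ℕ) : 𝓞 K) ∈ vbar.asIdeal) (hne : vbar ≠ v)
    (κ : ZpExtension K p) (hκ : κ.IsCyclotomic)
    (hR : letI := kerResAction ψ₀ K
      (GreenbergVatsal2000.datumStrictSelmer κ.kerSubgroup ↥ψ₀.toAddMonoidHom.ker p
        (bdpData ↥ψ₀.toAddMonoidHom.ker p vbar) ((W.baseChange K).badPlaces (𝓞 K)) :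
          Set (subgroupH1 κ.kerSubgroup ↥ψ₀.toAddMonoidHom.ker)).Finite) :
    {c : (W.baseChange K).subgroupH1 p κ.kerSubgroup | c ∈ selmerAc (W.baseChange K) p κ vbar ∅ ∧
      h1Map p κ.kerSubgroup (ψ₀.extendScalars K).toAddMonoidHom (ψ₀.extendScalars K).equivariant c = 0}.Finite := by
  letI := kerResAction ψ₀ K
  exact finite_selmerAc_inter_ker_h1Map p (ψ₀.extendScalars K) (kerToPrimary p ψ₀ K hdeg) (kerToPrimary_smul p ψ₀ K hdeg)
    (kerToPrimary_injective p ψ₀ K hdeg) (extendScalars_kerToPrimary p ψ₀ K hdeg) (exists_kerToPrimary_eq p ψ₀ K hdeg)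
    (by rw [Isogeny.degree_extendScalars]; exact hdeg) hK2 hpv hpvbar hne κ hκ hR

end Instantiation

section Core

open Field Literature.NumberTheory.EllipticCurves Literature.NumberTheory.EllipticCurves.GreenbergSelmer
  Literature.NumberTheory.GaloisRepresentations NumberField IsDedekindDomain WeierstrassCurve
  Literature.NumberTheory.EllipticCurves.IsogenySelmerInfty Literature.NumberTheory.EllipticCurves.Castella2018
  Literature.NumberTheory.EllipticCurves.Castella2018.AcSelmer

/-- **ROAD B RESIDUE AT DEGREE `p` from (B3) FOR CONTINUOUS ACTIONS ONLY** (generation 16): as `roadB_residue_p_core` below, but the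
hypothesis `hGL1c` is the body of (B3) `ResidualGL1FinitenessOdd` WEAKENED by the extra antecedent «the `Γ_K`-action on `M` is
continuous» (token-identical to the workfile-B def `ResidualGL1FinitenessOddCont`). Road B instantiates (B3) only at `M = E[ψ₀]`, whose
Galois action IS continuous (`WeierstrassCurve.continuous_smul_geomPoints`: `E(ℚ̄)` is a discrete `Γ_ℚ`-module), so the junk case of
(B3) (non-continuous actions on an abstract `M`) is never needed — and for continuous actions the tame input [P23] is a kernel theorem
(workfile B §TameContinuous). [cite: GreenbergLNM1716, §5, proof of Prop. 5.10] [cite: SilvermanAEC2009, VIII.§1, X.§4 Thm. X.4.2] -/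
theorem roadB_residue_p_core_of_cont
    (hGL1c : ∀ (K : Type) [Field K] [NumberField K], IsImaginaryQuadratic K →
      ∀ (p : ℕ) [Fact p.Prime], p ≠ 2 →
      ∀ (κ : ZpExtension K p), κ.IsCyclotomic →
      ∀ (v vbar : HeightOneSpectrum (𝓞 K)), ((p : ℕ) : 𝓞 K) ∈ v.asIdeal → ((p : ℕ) : 𝓞 K) ∈ vbar.asIdeal →
        vbar ≠ v →
      ∀ (S : Set (HeightOneSpectrum (𝓞 K))), S.Finite →
      ∀ (M : Type) [AddCommGroup M] [DistribMulAction (absoluteGaloisGroup ℚ) M]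
        [DistribMulAction (absoluteGaloisGroup K) M] [TopologicalSpace M] [DiscreteTopology M],
        Nat.card M = p →
        (∀ (σ : absoluteGaloisGroup K) (m : M), σ • m = (absGaloisRestrict ℚ K σ) • m) →
        (∀ m : M, Continuous fun σ : absoluteGaloisGroup K ↦ σ • m) →
        (GreenbergVatsal2000.datumStrictSelmer κ.kerSubgroup M p (AcSelmer.bdpData M p vbar) S :
          Set (subgroupH1 κ.kerSubgroup M)).Finite)
    (W W' : WeierstrassCurve ℚ) [W.IsElliptic] [W'.IsElliptic] (p : ℕ) [Fact p.Prime] (hp2 : 2 < p)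
    (ψ₀ : Isogeny W W') (hdeg : ψ₀.degree = p) (K : Type) [Field K] [NumberField K] (hK : IsImaginaryQuadratic K)
    (v vbar : HeightOneSpectrum (𝓞 K)) (hpv : ((p : ℕ) : 𝓞 K) ∈ v.asIdeal) (hpvbar : ((p : ℕ) : 𝓞 K) ∈ vbar.asIdeal)
    (hne : vbar ≠ v) (κ : ZpExtension K p) (hκ : κ.IsCyclotomic) :
    Finite {c : ↥(selmerAc (W.baseChange K) p κ vbar ∅) //
      h1Map p κ.kerSubgroup (ψ₀.extendScalars K).toAddMonoidHom (ψ₀.extendScalars K).equivariant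
        (c : (W.baseChange K).subgroupH1 p κ.kerSubgroup) = 0} := by
  letI := ψ₀.kerAction
  letI := kerResAction ψ₀ K
  -- the Galois action on `E[ψ₀] ⊆ E(ℚ̄)` is continuous (`E(ℚ̄)` is a discrete `Γ_ℚ`-module), hence so is the restricted `Γ_K`-action
  have hcontK : ∀ m : ↥ψ₀.toAddMonoidHom.ker, Continuous fun σ : absoluteGaloisGroup K ↦ σ • m := fun m ↦ by
    refine continuous_induced_rng.2 ?_
    show Continuous ((fun τ : absoluteGaloisGroup ℚ ↦ τ • (m : W.geomPoints)) ∘ (absGaloisRestrict ℚ K))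
    exact (W.continuous_smul_geomPoints (m : W.geomPoints)).comp (absGaloisRestrict ℚ K).continuous_toFun
  have hR := hGL1c K hK p hp2.ne' κ hκ v vbar hpv hpvbar hne ((W.baseChange K).badPlaces (𝓞 K))
    ((W.baseChange K).finite_badPlaces_holds (𝓞 K)) ↥ψ₀.toAddMonoidHom.ker hdeg (fun _ _ ↦ rfl) hcontK
  have hfin := finite_selmerAc_inter_ker_h1Map_extendScalars p ψ₀ K hdeg hK.1 hpv hpvbar hne κ hκ hR
  haveI := hfin.to_subtype
  refine Finite.of_injective
    (fun c ↦ (⟨(c.1 : (W.baseChange K).subgroupH1 p κ.kerSubgroup), c.1.2, c.2⟩ :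
      {c : (W.baseChange K).subgroupH1 p κ.kerSubgroup | c ∈ selmerAc (W.baseChange K) p κ vbar ∅ ∧
        h1Map p κ.kerSubgroup (ψ₀.extendScalars K).toAddMonoidHom (ψ₀.extendScalars K).equivariant c = 0}))
    (fun a b h ↦ by
      simp only [Subtype.mk.injEq] at h
      exact Subtype.ext (Subtype.ext h))


/-- **ROAD B RESIDUE AT DEGREE `p` — the owed main-file theorem `roadB_residue_p : RoadBResidueP`, in UNFOLDED form** (this workfile
cannot import the main line file, and the main file is at its byte cap). The hypothesis `hGL1` is, token for token, the body of the
main file's `ResidualGL1FinitenessOdd` ((B3), NOT proved here, NOT asserted); the binders are those of the main file's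
`KerSelmerMapFiniteOfDegreeP` (its two good-reduction hypotheses are not needed and omitted); the conclusion is finiteness of the
subtype of Castella's `Sel_{v̄}(K_∞, W_K[p^∞])` killed by `H¹((ψ₀,K)_*)`, into which the kernel of the main file's
`K2e.acSelmerMap p κ v̄ ∅ (ψ₀,K)_* _` injects by `c ↦ ⟨c, congrArg Subtype.val c.2⟩` (`K2e.coe_acSelmerMap_apply` is `rfl`), so that in
the main file `roadB_residue_p` is the three-line transport of this theorem. PROOF (memo §10, all pieces in this file):
`M := E[ψ₀] ⊆ E(ℚ̄)` with `Γ_K` acting through `res` (`kerResAction`, compatibility `rfl`), `#M = deg ψ₀ = p`, `S :=` the bad places of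
`W_K` (finite, `finite_badPlaces_holds`) instantiate `hGL1`; then `finite_selmerAc_inter_ker_h1Map_extendScalars` ((R1) cocycle lift
to `H¹(K_∞, E[ψ₀])`, (R4) unramified outside `p ∪ S` by Néron–Ogg–Shafarevich, strict at `v̄` up to the finite local kernel (R3) after
the one-double-coset collapse (R2) `Γ_K = I_v̄ · Gal(K̄/K_∞)` for the cyclotomic tower, (R5) finite fibres over the residual strict
Selmer group). No summit statement, crux or stub is proved here: this discharges (B1c) at degree `p` GIVEN (B3).
[cite: GreenbergLNM1716, §5, proof of Prop. 5.10] [cite: GreenbergVatsal2000, §2 (Prop. 2.8 and its proof)]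
[cite: SilvermanAEC2009, VII.§4 Thm. VII.4.1, X.§4 Thm. X.4.2] -/
theorem roadB_residue_p_core
    (hGL1 : ∀ (K : Type) [Field K] [NumberField K], IsImaginaryQuadratic K →
      ∀ (p : ℕ) [Fact p.Prime], p ≠ 2 →
      ∀ (κ : ZpExtension K p), κ.IsCyclotomic →
      ∀ (v vbar : HeightOneSpectrum (𝓞 K)), ((p : ℕ) : 𝓞 K) ∈ v.asIdeal → ((p : ℕ) : 𝓞 K) ∈ vbar.asIdeal →
        vbar ≠ v →
      ∀ (S : Set (HeightOneSpectrum (𝓞 K))), S.Finite →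
      ∀ (M : Type) [AddCommGroup M] [DistribMulAction (absoluteGaloisGroup ℚ) M]
        [DistribMulAction (absoluteGaloisGroup K) M] [TopologicalSpace M] [DiscreteTopology M],
        Nat.card M = p →
        (∀ (σ : absoluteGaloisGroup K) (m : M), σ • m = (absGaloisRestrict ℚ K σ) • m) →
        (GreenbergVatsal2000.datumStrictSelmer κ.kerSubgroup M p (AcSelmer.bdpData M p vbar) S :
          Set (subgroupH1 κ.kerSubgroup M)).Finite)
    (W W' : WeierstrassCurve ℚ) [W.IsElliptic] [W'.IsElliptic] (p : ℕ) [Fact p.Prime] (hp2 : 2 < p)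
    (ψ₀ : Isogeny W W') (hdeg : ψ₀.degree = p) (K : Type) [Field K] [NumberField K] (hK : IsImaginaryQuadratic K)
    (v vbar : HeightOneSpectrum (𝓞 K)) (hpv : ((p : ℕ) : 𝓞 K) ∈ v.asIdeal) (hpvbar : ((p : ℕ) : 𝓞 K) ∈ vbar.asIdeal)
    (hne : vbar ≠ v) (κ : ZpExtension K p) (hκ : κ.IsCyclotomic) :
    Finite {c : ↥(selmerAc (W.baseChange K) p κ vbar ∅) //
      h1Map p κ.kerSubgroup (ψ₀.extendScalars K).toAddMonoidHom (ψ₀.extendScalars K).equivariant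
        (c : (W.baseChange K).subgroupH1 p κ.kerSubgroup) = 0} :=
  roadB_residue_p_core_of_cont
    (fun K _ _ hK p _ hp2 κ hκ v vbar hpv hpvbar hne S hS M _ _ _ _ _ hcard hprov _ ↦
      hGL1 K hK p hp2 κ hκ v vbar hpv hpvbar hne S hS M hcard hprov)
    W W' p hp2 ψ₀ hdeg K hK v vbar hpv hpvbar hne κ hκ

end Core

section Transport

open Field Literature.NumberTheory.EllipticCurves Literature.NumberTheory.EllipticCurves.GreenbergSelmer
  Literature.NumberTheory.GaloisRepresentations NumberField IsDedekindDomain WeierstrassCurve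
  Literature.NumberTheory.EllipticCurves.IsogenySelmerInfty Literature.NumberTheory.EllipticCurves.Castella2018
  Literature.NumberTheory.EllipticCurves.Castella2018.AcSelmer

/-- **Road B, (B1c) at degree exactly `p`: `RoadBResidueP` holds** — the registered stub `stub_roadBResidueP` of
`interlude_with_torsion` v8, BY NAME (`InterludeWithTorsion.RoadBResidueP := ResidualGL1FinitenessOdd → KerSelmerMapFiniteOfDegreeP`,
tree `…InterludeDefs`; `K2e.acSelmerMap` the tree def of `…InterludeSelmerIsogenyMaps`). Three-line transport of
`roadB_residue_p_core`: the kernel of the Selmer map injects into the classes killed by `ψ₀_*` (`codRestrict`/`subtype`, `rfl`).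
[cite: GreenbergLNM1716, §5, proof of Prop. 5.10] [folklore] -/
theorem roadBResidueP_holds : InterludeWithTorsion.RoadBResidueP := by
  intro hGL1 W W' _ _ p _ hp2 _ _ ψ₀ hdeg K _ _ hK v vbar hpv hpvbar hne κ hκ
  haveI := roadB_residue_p_core hGL1 W W' p hp2 ψ₀ hdeg K hK v vbar hpv hpvbar hne κ hκ
  exact Finite.of_injective (fun c ↦ (⟨c.1, congrArg Subtype.val c.2⟩ :
      {c : ↥(selmerAc (W.baseChange K) p κ vbar ∅) // h1Map p κ.kerSubgroup (ψ₀.extendScalars K).toAddMonoidHom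
        (ψ₀.extendScalars K).equivariant (c : (W.baseChange K).subgroupH1 p κ.kerSubgroup) = 0}))
    (fun a b h ↦ Subtype.ext (by simpa using congrArg Subtype.val h))

/-- **(B1c) at degree `p` from (B3) FOR CONTINUOUS ACTIONS** (generation 16): `InterludeWithTorsion.KerSelmerMapFiniteOfDegreeP` BY NAME
from the body of (B3) weakened by the continuity antecedent (= workfile B's `ResidualGL1FinitenessOddCont`, token for token). With
workfile B rev 4 (`residualGL1FinitenessOddCont_of_inputs : GL1InputUnramifiedCont → GL1InputSplitPrimeCont → ResidualGL1FinitenessOddCont`,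
[P23] a theorem) road B's owed inputs become exactly the two classical `μ = 0` statements [P1]/[Cv] for continuous characters of order
dividing `p − 1` — junk-free. A LEAD reshape could take `ResidualGL1FinitenessOddCont` as the road-B stub and close `hB1c ∘ hGL1` of the
descent by this theorem. [cite: GreenbergLNM1716, §5, proof of Prop. 5.10] [folklore] -/
theorem kerSelmerMapFiniteOfDegreeP_of_residualCont
    (hGL1c : ∀ (K : Type) [Field K] [NumberField K], IsImaginaryQuadratic K →
      ∀ (p : ℕ) [Fact p.Prime], p ≠ 2 →
      ∀ (κ : ZpExtension K p), κ.IsCyclotomic →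
      ∀ (v vbar : HeightOneSpectrum (𝓞 K)), ((p : ℕ) : 𝓞 K) ∈ v.asIdeal → ((p : ℕ) : 𝓞 K) ∈ vbar.asIdeal →
        vbar ≠ v →
      ∀ (S : Set (HeightOneSpectrum (𝓞 K))), S.Finite →
      ∀ (M : Type) [AddCommGroup M] [DistribMulAction (absoluteGaloisGroup ℚ) M]
        [DistribMulAction (absoluteGaloisGroup K) M] [TopologicalSpace M] [DiscreteTopology M],
        Nat.card M = p →
        (∀ (σ : absoluteGaloisGroup K) (m : M), σ • m = (absGaloisRestrict ℚ K σ) • m) →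
        (∀ m : M, Continuous fun σ : absoluteGaloisGroup K ↦ σ • m) →
        (GreenbergVatsal2000.datumStrictSelmer κ.kerSubgroup M p (AcSelmer.bdpData M p vbar) S :
          Set (subgroupH1 κ.kerSubgroup M)).Finite) :
    InterludeWithTorsion.KerSelmerMapFiniteOfDegreeP := by
  intro W W' _ _ p _ hp2 _ _ ψ₀ hdeg K _ _ hK v vbar hpv hpvbar hne κ hκ
  haveI := roadB_residue_p_core_of_cont hGL1c W W' p hp2 ψ₀ hdeg K hK v vbar hpv hpvbar hne κ hκ
  exact Finite.of_injective (fun c ↦ (⟨c.1, congrArg Subtype.val c.2⟩ :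
      {c : ↥(selmerAc (W.baseChange K) p κ vbar ∅) // h1Map p κ.kerSubgroup (ψ₀.extendScalars K).toAddMonoidHom
        (ψ₀.extendScalars K).equivariant (c : (W.baseChange K).subgroupH1 p κ.kerSubgroup) = 0}))
    (fun a b h ↦ Subtype.ext (by simpa using congrArg Subtype.val h))

end Transport

end Summit.BirchSwinnertonDyer.BirchSwinnertonDyer.Theorems.InterludeWithTorsion.RoadBHelpers
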